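import Summits.BirchSwinnertonDyer.BirchSwinnertonDyer.Theorems.ByReductionTypeAtTwoMultTowerNS2LayerZeroUnitClass
import Summits.BirchSwinnertonDyer.BirchSwinnertonDyer.Theorems.ByReductionTypeAtTwoMultTowerNS2LayerZeroTateVal
import HarnessLib

/-!
# Route `ByReductionTypeAtTwo`, crux `MultUpperHalfAtTwo` (item stmt-BirchSwinnertonDyer-19922), TOWER road, NON-SPLIT rows:
# the layer-`0` order of the local tower kernel at a non-split `2`, part 5 — `ord₂ Δ_min` ODD ⟹ `#𝒦_{v,0}[2^∞] ≤ 2`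

HONEST FRAMING (cell `bsd-2adic`, run/shared/lean/pub/bsd-2adic/, seat `bsd-2adic-tower-1` GEN 30, HUMAN RULINGS
D-0036 / D-0054 / D-0074): theorems only (no definition, no named fact, no `sorry`); closes nothing by itself; nothing
booked; BSD is not proved by any of this. Fifth brick of the layer-`0` count `#𝒦_{v,0}[2^∞] = 2·c₂^{(2)}` at a non-split
multiplicative `2` (R. Greenberg, LNM 1716, §4 p. 113 «If p = 2, then `|ker(r_v)| = 2c_v^{(p)}`»; §3 p. 93 at `n = 0`),
the hypothesis `hcount` of `MultEulerChar.twoAdicEulerCharRankZeroNonsplitMult_of_layerZeroCount` (GEN 29). Scope memo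
`tower/SCOPE-NS2-LAYER0-EXACT-GEN29.md` (L2-upper). When `m = ord₂ Δ_min` is ODD (Tamagawa number `c₂ = 1`) the UPPER
bound drops from hNS2's `4` (`MultTowerNS2.finite_and_natCard_localTowerKerPrimary_le_four_nonsplitTwo`, every layer) to `2`
at the layer `0`:

* `exists_div_eq_zpow_mul_coboundary_of_three_pow_of_odd` — among THREE `2^k`-torsion data of the layer-`0` twisted Tate
  module two are congruent modulo `B = Q^ℤ·(g−1)T` when `|Q|_v = |2|_v^m`, `m` odd: two exponents share a parity
  (pigeonhole), the quotient datum (`div_powTorsion_data`) normalised to the unit circle (`smul_mul_zpow_inv_pow`) is a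
  coboundary by part 3 `exists_coboundary_of_unitExponent_of_odd`;
* `powTorsion_localTowerKerPrimary_zero_le_two_nonsplitTwo_of_odd` — **`#𝒦_{v,0}[2^∞][2^k] ≤ 2` for every `k`** when
  `ord_v Δ_min` is odd: GEN 27's assembly `MultTowerNS2.powTorsion_localTowerKerPrimary_le_four_nonsplitTwo` run at the layer
  `0` with three classes instead of five (`m = ord_v Δ_min` by part 4 `spectralValuation_tateParameter_eq_pow_ordMinimalDiscriminant`);
* `finite_and_natCard_localTowerKerPrimary_zero_le_two_nonsplitTwo_of_odd` — **`#𝒦_{v,0}[2^∞] ≤ 2`** (2-primary exhaustion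
  `MultTowerNS2.finite_and_natCard_le_of_forall_torsionBy_pow`).
What is NOT here: the lower bounds (`≥ 2` for `m` odd, `≥ 4` for `m` even — relative norm existence for the cyclic layers
`K̄^{H_n ∩ Stab t}/ℚ_v(t)`, next parts) and the final assembly of `hcount`.

References: R. Greenberg, LNM 1716 (1999), §3 p. 93, §4 pp. 112–113; J. Silverman, GTM 151, V.3–V.5; J. Neukirch, *ANT*
IV (3.5), V (1.1).
-/

set_option autoImplicit false
-- the Theorems namespace of this sub repeats the summit name by design (D-0017 nested layout: Summit.<S>.<Sub>)
set_option linter.dupNamespace false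

noncomputable section

open scoped Classical IntermediateField NNReal

namespace Summit.BirchSwinnertonDyer.BirchSwinnertonDyer.Theorems.MultTowerNS2LayerZero

open NumberField IsDedekindDomain Field WeierstrassCurve PadicInt Rat.HeightOneSpectrum
  Literature.NumberTheory.EllipticCurves Literature.NumberTheory.EllipticCurves.ResKernel
  Literature.NumberTheory.GaloisRepresentations
  Summit.BirchSwinnertonDyer.BirchSwinnertonDyer.Theorems.MultTowerNS2 IsDedekindDomain.HeightOneSpectrum

variable {κ : ZpExtension ℚ 2}

/-! ### Among THREE `2^k`-torsion data of the layer-`0` twisted Tate module two are congruent (`m` odd) -/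

/-- **`ord₂ q_E` ODD: no three pairwise incongruent `2^k`-torsion elements at the layer `0`.** Setting of parts 1–3
(`v ∋ 2`, `W` globally minimal multiplicative at `2`, `κ` cyclotomic, `t² = γ(W)`, a flip `τ₀ ∈ H_∞`, a generator `g` at the
layer `0` fixing `t`, `Q = q_E` with `|Q|_v = |2|_v^m`, `m` odd). Among any three `x₀, x₁, x₂` fixed by `H_∞ ∩ Stab(t)` with
`τ₀x_i·x_i = Q^{a_i}` and `x_i^{2^k} = Q^{j_i}·(gz_i/z_i)` (`z_i ∈ T`), two are congruent modulo `B = Q^ℤ·(g−1)T`: two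
exponents `a_i, a_{i'}` have the same parity, the quotient `x_i/x_{i'}` is a `2^k`-torsion datum of even exponent `2c`
(`div_powTorsion_data`), `x_i/x_{i'}·Q^{-c}` has unit exponent (`smul_mul_zpow_inv_pow`) and is therefore a coboundary `gy/y`
with `y ∈ T` (part 3 `exists_coboundary_of_unitExponent_of_odd`). [cite: GreenbergLNM1716, §3 p. 93 and §4 p. 113] -/
theorem exists_div_eq_zpow_mul_coboundary_of_three_pow_of_odd (W : WeierstrassCurve ℚ) [W.IsElliptic]
    [W.IsGloballyMinimal] (hmult : W.HasMultiplicativeReductionAtPrime 2) (hκ : κ.IsCyclotomic)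
    (v : HeightOneSpectrum (𝓞 ℚ)) (hv : ((2 : ℕ) : 𝓞 ℚ) ∈ v.asIdeal) {t : AlgebraicClosure (v.adicCompletion ℚ)}
    (ht2 : t ^ 2 = algebraMap (v.adicCompletion ℚ) (AlgebraicClosure (v.adicCompletion ℚ))
      (algebraMap ℚ (v.adicCompletion ℚ) (-(W.c₄ / W.c₆))))
    (ht : ∀ σ : absoluteGaloisGroup (v.adicCompletion ℚ), σ • t = t ∨ σ • t = -t) (ht0 : t ≠ 0)
    {τ₀ : absoluteGaloisGroup (v.adicCompletion ℚ)} (hτ₀ : τ₀ ∈ localSubgroup κ.kerSubgroup (v.adicCompletion ℚ))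
    (hτ₀t : τ₀ • t = -t) {g : absoluteGaloisGroup (v.adicCompletion ℚ)} {u : ℤ_[2]ˣ}
    (hu : ((κ (resGal (K := ℚ) (v.adicCompletion ℚ) g)).toAdd : ℤ_[2]) = 2 ^ 0 * (u : ℤ_[2])) (hgt : g • t = t)
    {Q : AlgebraicClosure (v.adicCompletion ℚ)} (hQfix : ∀ σ : absoluteGaloisGroup (v.adicCompletion ℚ), σ • Q = Q)
    (hQ0 : Q ≠ 0) (hQtor : ∀ j : ℤ, Q ^ j = 1 → j = 0)
    {w : Valuation (AlgebraicClosure (v.adicCompletion ℚ)) ℝ≥0}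
    (hw : ∀ x, (w x : ℝ) = spectralNorm (v.adicCompletion ℚ) (AlgebraicClosure (v.adicCompletion ℚ)) x)
    {m : ℕ} (hQm : w Q = w 2 ^ m) (hm : Odd m)
    (k : ℕ) {x z : Fin 3 → AlgebraicClosure (v.adicCompletion ℚ)} {a j jz : Fin 3 → ℤ} (hx0 : ∀ i, x i ≠ 0)
    (hxL : ∀ i, ∀ h ∈ localSubgroup κ.kerSubgroup (v.adicCompletion ℚ), h • t = t → h • x i = x i)
    (hxa : ∀ i, τ₀ • x i * x i = Q ^ a i) (hz0 : ∀ i, z i ≠ 0)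
    (hzL : ∀ i, ∀ h ∈ localSubgroup κ.kerSubgroup (v.adicCompletion ℚ), h • t = t → h • z i = z i)
    (hzj : ∀ i, τ₀ • z i * z i = Q ^ jz i) (hxk : ∀ i, x i ^ 2 ^ k = Q ^ j i * (g • z i / z i)) :
    ∃ i i' : Fin 3, i ≠ i' ∧ ∃ (c' : ℤ) (y : AlgebraicClosure (v.adicCompletion ℚ)), y ≠ 0 ∧
      (∀ h ∈ localSubgroup κ.kerSubgroup (v.adicCompletion ℚ), h • t = t → h • y = y) ∧
      (∃ jy : ℤ, τ₀ • y * y = Q ^ jy) ∧ x i / x i' = Q ^ c' * (g • y / y) := by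
  -- two indices with exponents of the same parity
  obtain ⟨i, i', hii', hpar⟩ :=
    Fintype.exists_ne_map_eq_of_card_lt (fun i : Fin 3 ↦ decide (Even (a i))) (by simp)
  have heven : Even (a i - a i') := Int.even_sub.mpr (decide_eq_decide.mp hpar)
  obtain ⟨c, hc⟩ : ∃ c : ℤ, a i - a i' = 2 * c := by
    obtain ⟨r, hr⟩ := heven
    exact ⟨r, by rw [hr]; ring⟩
  -- the quotient datum `x i / x i'`, of even exponent `2c`
  obtain ⟨hX0, hXL, hXa, hZ0, hZL, hZj, hXk⟩ := div_powTorsion_data (κ := κ) v hQ0 k (hx0 i) (hx0 i') (hxL i) (hxL i')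
    (hxa i) (hxa i') (hz0 i) (hz0 i') (hzL i) (hzL i') (hzj i) (hzj i') (hxk i) (hxk i')
  rw [hc] at hXa
  -- normalised to the unit circle it is a coboundary `g y / y`, `y ∈ T` (part 3)
  obtain ⟨hX'L, hX'U, hX'k⟩ := smul_mul_zpow_inv_pow (κ := κ) v hQfix hQ0 hXL hXa (2 ^ k) hXk
  obtain ⟨y, ay, hy0, hyL, hya, hXy⟩ := exists_coboundary_of_unitExponent_of_odd W hmult hκ v hv ht2 ht ht0 hτ₀ hτ₀t hu
    hgt hQfix hQ0 hQtor hw hQm hm hX'L hX'U k hZ0 hZL hZj hX'k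
  refine ⟨i, i', hii', c, y, hy0, hyL, ⟨ay, hya⟩, ?_⟩
  have hQc : Q ^ c ≠ 0 := zpow_ne_zero _ hQ0
  rw [← hXy]
  field_simp

/-! ### `ord_v Δ_min` odd ⟹ `#𝒦_{v,0}[2^∞][2^k] ≤ 2` -/

/-- **`#𝒦_{v,0}[2^∞][2^k] ≤ 2` when `ord_v(Δ_min)` is ODD — KERNEL theorem.** For a globally minimal `W/ℚ`, multiplicative
and NON-SPLIT at `2` with `ord_v(Δ_min)` odd (Tamagawa number `c₂ = 1`), every cyclotomic `ℤ₂`-datum `κ`, the place `v ∋ 2`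
and every `k`, the `2^k`-torsion of the layer-`0` local tower kernel `𝒦_{v,0}[2^∞]` is finite of order at most `2`. Proof =
GEN 27's `MultTowerNS2.powTorsion_localTowerKerPrimary_le_four_nonsplitTwo` at the layer `0` with «five classes» replaced by
«three classes» (`exists_div_eq_zpow_mul_coboundary_of_three_pow_of_odd`; `|q_E|_v = |2|_v^{ord_v Δ_min}` by
`spectralValuation_tateParameter_eq_pow_ordMinimalDiscriminant`). [cite: GreenbergLNM1716, §3 p. 93 and §4 p. 113]
[cite: SilvermanATAEC1994, Thm. V.5.3, Lemma V.5.1] -/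
theorem powTorsion_localTowerKerPrimary_zero_le_two_nonsplitTwo_of_odd (W : WeierstrassCurve ℚ) [W.IsElliptic]
    [W.IsGloballyMinimal] (hmult : W.HasMultiplicativeReductionAtPrime 2)
    (hns : ¬ W.HasSplitMultiplicativeReductionAtPrime 2) (hκ : κ.IsCyclotomic) (v : HeightOneSpectrum (𝓞 ℚ))
    (hv : ((2 : ℕ) : 𝓞 ℚ) ∈ v.asIdeal) (hodd : Odd (W.ordMinimalDiscriminant v)) (k : ℕ) :
    Finite {x : W.localTowerKerPrimary κ (v.adicCompletion ℚ) 0 // 2 ^ k • x = 0} ∧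
      Nat.card {x : W.localTowerKerPrimary κ (v.adicCompletion ℚ) 0 // 2 ^ k • x = 0} ≤ 2 := by
  -- S0: multiplicative reduction at the place `v`
  haveI hfact : Fact (Nat.Prime (primesEquiv v : ℕ)) := ⟨(primesEquiv v).2⟩
  have hp2 : ((primesEquiv v : Nat.Primes) : ℕ) = 2 := primesEquiv_eq_of_natCast_mem v Nat.prime_two hv
  have hmultv : W.HasMultiplicativeReductionAt v :=
    (hasMultiplicativeReductionAtPrime_iff_hasMultiplicativeReductionAt_ringOfIntegers (W := W) v).mp
      ((KatoHalfPinch.hasMultiplicativeReductionAtPrime_congr W hp2).mpr hmult)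
  -- Tate's twisted uniformisation at `v`
  obtain ⟨q, t, Ψ, hq0, hqv, hqj, -, ht0, ht2, hsurj, hker, hequiv⟩ :=
    TateCurve.exists_twistedTateUniformisation_tateJ W v hmultv
  set Q : AlgebraicClosure (v.adicCompletion ℚ) :=
    algebraMap (v.adicCompletion ℚ) (AlgebraicClosure (v.adicCompletion ℚ)) q with hQ
  have hQ0 : Q ≠ 0 := by rw [hQ]; exact (map_ne_zero _).mpr hq0
  have hQfix : ∀ σ : absoluteGaloisGroup (v.adicCompletion ℚ), σ • Q = Q := fun σ ↦
    AlgEquiv.commutes (absoluteGaloisGroup.toAlgEquiv _ σ) q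
  have hQtor : ∀ j : ℤ, Q ^ j = 1 → j = 0 := by
    intro j hj
    have hj' : q ^ j = 1 := by
      apply (algebraMap (v.adicCompletion ℚ) (AlgebraicClosure (v.adicCompletion ℚ))).injective
      rw [map_zpow₀, map_one]; exact hj
    have hq1 : ‖q‖ < 1 := Valued.toNormedField.norm_lt_one_iff.mpr hqv
    have hpow : ∀ m : ℕ, q ^ m = 1 → m = 0 := fun m hm ↦ by
      by_contra hm0
      have h1 : ‖q‖ ^ m < 1 := pow_lt_one₀ (norm_nonneg q) hq1 hm0
      rw [← norm_pow, hm, norm_one] at h1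
      exact lt_irrefl _ h1
    cases j with
    | ofNat m =>
      rw [Int.ofNat_eq_natCast, zpow_natCast] at hj'
      rw [Int.ofNat_eq_natCast, hpow m hj']
      rfl
    | negSucc m =>
      rw [zpow_negSucc, inv_eq_one] at hj'
      exact absurd (hpow (m + 1) hj') (Nat.succ_ne_zero m)
  -- the spectral valuation and `|Q|_v = |2|_v^m`, `m = ord_v Δ_min` odd
  obtain ⟨w, hw⟩ := v.exists_spectralValuation
  have hQm : w Q = w 2 ^ (W.ordMinimalDiscriminant v) :=
    spectralValuation_tateParameter_eq_pow_ordMinimalDiscriminant W hmult v hv hqj hw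
  -- `σ t = ± t`, `-t ≠ t`
  have ht : ∀ σ : absoluteGaloisGroup (v.adicCompletion ℚ), σ • t = t ∨ σ • t = -t := fun σ ↦ by
    apply sq_eq_sq_iff_eq_or_eq_neg.mp
    rw [← smul_pow', ht2]
    exact AlgEquiv.commutes (absoluteGaloisGroup.toAlgEquiv _ σ) _
  have hne : -t ≠ t := neg_ne_self_of_ne_zero v ht0
  -- equivariance in value form
  have hequiv' : ∀ (σ : absoluteGaloisGroup (v.adicCompletion ℚ)) (w w' : (AlgebraicClosure (v.adicCompletion ℚ))ˣ),
      (w' : AlgebraicClosure (v.adicCompletion ℚ)) = σ • (w : AlgebraicClosure (v.adicCompletion ℚ)) →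
        σ • Ψ (Additive.ofMul w) = (if σ • t = t then (1 : ℤ) else -1) • Ψ (Additive.ofMul w') := by
    intro σ w w' h
    have hw' : w' = Units.map (absoluteGaloisGroup.toAlgEquiv (v.adicCompletion ℚ) σ :
        AlgebraicClosure (v.adicCompletion ℚ) →* AlgebraicClosure (v.adicCompletion ℚ)) w := Units.ext h
    rw [hw']
    exact hequiv σ w
  -- the flip `τ₀ ∈ H_∞` (BRICK 10)
  obtain ⟨τ₀, hτ₀, hτ₀t⟩ :=
    exists_mem_localSubgroup_kerSubgroup_smul_sqrt_gamma_eq_neg W hκ hmult hns v hv t ht2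
  -- a topological generator `g` of `H₀ = Γ` modulo `H_∞` FIXING `t`
  have hile : localSubgroup κ.kerSubgroup (v.adicCompletion ℚ) ≤ localSubgroup (κ.layerSubgroup 0) (v.adicCompletion ℚ) :=
    fun τ hτ ↦ by
      rw [mem_localSubgroup_iff] at hτ ⊢
      exact κ.kerSubgroup_le_layerSubgroup 0 hτ
  obtain ⟨g, hgn, hgen, hgt⟩ : ∃ g ∈ localSubgroup (κ.layerSubgroup 0) (v.adicCompletion ℚ),
      (∀ U : Subgroup (absoluteGaloisGroup (v.adicCompletion ℚ)),
        IsOpen (U : Set (absoluteGaloisGroup (v.adicCompletion ℚ))) →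
          localSubgroup κ.kerSubgroup (v.adicCompletion ℚ) ≤ U → g ∈ U →
            localSubgroup (κ.layerSubgroup 0) (v.adicCompletion ℚ) ≤ U) ∧ g • t = t := by
    obtain ⟨g₀, hg₀, hg₀gen⟩ := ZpExtension.exists_mem_localSubgroup_generate κ (v.adicCompletion ℚ) 0
    rcases ht g₀ with h | h
    · exact ⟨g₀, hg₀, hg₀gen, h⟩
    · refine ⟨g₀ * τ₀, Subgroup.mul_mem _ hg₀ (hile hτ₀), fun U hU hiU hgU ↦ hg₀gen U hU hiU ?_, ?_⟩
      · have h1 := U.mul_mem hgU (U.inv_mem (hiU hτ₀))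
        rwa [mul_inv_cancel_right] at h1
      · rw [mul_smul, hτ₀t, smul_neg, h, neg_neg]
  -- `κ(res g) = 2^0 · unit` (BRICK 15)
  obtain ⟨ug, hug⟩ := exists_units_kappa_resGal_eq_of_generate hκ v hv 0 hgn hgen
  -- the coinvariants `M_∞/(g-1)M_∞`
  set P := localPoints W (v.adicCompletion ℚ) with hP
  set M : AddSubgroup P :=
    FixedPoints.addSubgroup (localSubgroup κ.kerSubgroup (v.adicCompletion ℚ)) P with hM
  have memM : ∀ {a : P}, a ∈ M ↔ ∀ h ∈ localSubgroup κ.kerSubgroup (v.adicCompletion ℚ), h • a = a := fun {a} ↦ by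
    rw [hM, FixedPoints.mem_addSubgroup]
    exact ⟨fun H h hh ↦ H ⟨h, hh⟩, fun H h ↦ H h h.2⟩
  set d : M →+ M := subOne (localSubgroup κ.kerSubgroup (v.adicCompletion ℚ)) P g with hd
  -- every `2^k`-torsion class has a representative `Ψ x`, `x ∈ T`, with `x^{2^k} = Q^j · gz/z`, `z ∈ T`
  have hrep : ∀ y : {y : M ⧸ d.range // 2 ^ k • y = 0},
      ∃ (x z : (AlgebraicClosure (v.adicCompletion ℚ))ˣ) (a j jz : ℤ) (m : M),
        (m : M ⧸ d.range) = y.1 ∧ (m : P) = Ψ (Additive.ofMul x) ∧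
        (∀ h ∈ localSubgroup κ.kerSubgroup (v.adicCompletion ℚ), h • t = t →
          h • (x : AlgebraicClosure (v.adicCompletion ℚ)) = x) ∧
        τ₀ • (x : AlgebraicClosure (v.adicCompletion ℚ)) * x = Q ^ a ∧
        (∀ h ∈ localSubgroup κ.kerSubgroup (v.adicCompletion ℚ), h • t = t →
          h • (z : AlgebraicClosure (v.adicCompletion ℚ)) = z) ∧
        τ₀ • (z : AlgebraicClosure (v.adicCompletion ℚ)) * z = Q ^ jz ∧
        (x : AlgebraicClosure (v.adicCompletion ℚ)) ^ 2 ^ k =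
          Q ^ j * (g • (z : AlgebraicClosure (v.adicCompletion ℚ)) / z) := by
    rintro ⟨y, hy⟩
    obtain ⟨m, rfl⟩ := QuotientAddGroup.mk_surjective y
    obtain ⟨x, hxm, hxL, a, hxa⟩ := exists_unit_of_mem_fixedPoints (κ := κ) v hsurj hker hequiv' hQfix hQ0 hQtor hne
      hτ₀ hτ₀t (memM.mp m.2)
    have h2m : (2 ^ k • m : M) ∈ d.range := by
      rw [← QuotientAddGroup.eq_zero_iff]
      exact hy
    obtain ⟨w₁, hw₁⟩ := h2m
    obtain ⟨z, hzm, hzL, jz, hzj⟩ := exists_unit_of_mem_fixedPoints (κ := κ) v hsurj hker hequiv' hQfix hQ0 hQtor hne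
      hτ₀ hτ₀t (memM.mp w₁.2)
    set gz : (AlgebraicClosure (v.adicCompletion ℚ))ˣ :=
      Units.mk0 (g • (z : AlgebraicClosure (v.adicCompletion ℚ))) ((smul_ne_zero_iff_ne g).mpr z.ne_zero) with hgz
    have hgΨ : g • Ψ (Additive.ofMul z) = Ψ (Additive.ofMul gz) := by
      have h1 := hequiv' g z gz rfl
      rw [if_pos hgt, one_zsmul] at h1
      exact h1
    have h3 : Ψ (Additive.ofMul (x ^ 2 ^ k)) = Ψ (Additive.ofMul (gz * z⁻¹)) := by
      rw [ofMul_pow, map_nsmul, hxm, ofMul_mul, ofMul_inv, map_add, map_neg, ← hgΨ, hzm, ← sub_eq_add_neg]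
      have h4 := congrArg (fun b : M ↦ (b : P)) hw₁
      simp only [hd, AddSubgroupClass.coe_nsmul] at h4
      exact h4.symm
    rw [tatePsi_eq_iff v hker] at h3
    obtain ⟨j, hj⟩ := h3
    refine ⟨x, z, a, j, jz, m, rfl, hxm.symm, hxL, hxa, hzL, hzj, ?_⟩
    rw [Units.val_pow_eq_pow_val] at hj
    rw [hj, Units.val_mul, Units.val_inv_eq_inv_val, hgz, Units.val_mk0, div_eq_mul_inv]
  choose x z a j jz m hmy hmx hxL hxa hzL hzj hxk using hrep
  -- among THREE `2^k`-torsion classes two coincide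
  have key3 : ∀ ys : Fin 3 → {y : M ⧸ d.range // 2 ^ k • y = 0}, ∃ i i' : Fin 3, i ≠ i' ∧ ys i = ys i' := by
    intro ys
    obtain ⟨i, i', hii', cc, w₁, hw0, hwL, ⟨jw, hwj⟩, hrel⟩ :=
      exists_div_eq_zpow_mul_coboundary_of_three_pow_of_odd W hmult hκ v hv ht2 ht ht0 hτ₀ hτ₀t hug hgt hQfix hQ0
        hQtor hw hQm hodd k
        (x := fun i ↦ (x (ys i) : AlgebraicClosure (v.adicCompletion ℚ)))
        (z := fun i ↦ (z (ys i) : AlgebraicClosure (v.adicCompletion ℚ)))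
        (a := fun i ↦ a (ys i)) (j := fun i ↦ j (ys i)) (jz := fun i ↦ jz (ys i))
        (fun i ↦ (x (ys i)).ne_zero) (fun i ↦ hxL (ys i)) (fun i ↦ hxa (ys i)) (fun i ↦ (z (ys i)).ne_zero)
        (fun i ↦ hzL (ys i)) (fun i ↦ hzj (ys i)) (fun i ↦ hxk (ys i))
    refine ⟨i, i', hii', ?_⟩
    -- `Ψ (x i) - Ψ (x i') = (g - 1) Ψ(w₁)` with `Ψ w₁ ∈ M_∞`
    set wu : (AlgebraicClosure (v.adicCompletion ℚ))ˣ := Units.mk0 w₁ hw0 with hwu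
    have hwM : Ψ (Additive.ofMul wu) ∈ M :=
      memM.mpr (apply_mem_fixedPoints (κ := κ) v hker hequiv' ht hne hτ₀ hτ₀t (x := wu)
        (fun h hh hht ↦ by rw [hwu, Units.val_mk0]; exact hwL h hh hht) (a := jw) (by rw [hwu, Units.val_mk0]; exact hwj))
    set gw : (AlgebraicClosure (v.adicCompletion ℚ))ˣ :=
      Units.mk0 (g • w₁) ((smul_ne_zero_iff_ne g).mpr hw0) with hgw
    have hgΨ : g • Ψ (Additive.ofMul wu) = Ψ (Additive.ofMul gw) := by
      have h1 := hequiv' g wu gw (by rw [hgw, hwu, Units.val_mk0, Units.val_mk0])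
      rw [if_pos hgt, one_zsmul] at h1
      exact h1
    have hdP : (d ⟨Ψ (Additive.ofMul wu), hwM⟩ : P) = g • Ψ (Additive.ofMul wu) - Ψ (Additive.ofMul wu) := rfl
    have hdiff : Ψ (Additive.ofMul (x (ys i))) - Ψ (Additive.ofMul (x (ys i'))) =
        (d ⟨Ψ (Additive.ofMul wu), hwM⟩ : P) := by
      rw [hdP, hgΨ]
      have e1 : Ψ (Additive.ofMul (x (ys i))) - Ψ (Additive.ofMul (x (ys i'))) =
          Ψ (Additive.ofMul (x (ys i) * (x (ys i'))⁻¹)) := by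
        rw [ofMul_mul, ofMul_inv, map_add, map_neg, sub_eq_add_neg]
      have e2 : Ψ (Additive.ofMul gw) - Ψ (Additive.ofMul wu) = Ψ (Additive.ofMul (gw * wu⁻¹)) := by
        rw [ofMul_mul, ofMul_inv, map_add, map_neg, sub_eq_add_neg]
      rw [e1, e2, tatePsi_eq_iff v hker]
      refine ⟨cc, ?_⟩
      rw [Units.val_mul, Units.val_inv_eq_inv_val, Units.val_mul, Units.val_inv_eq_inv_val, hgw, hwu, Units.val_mk0,
        Units.val_mk0, ← div_eq_mul_inv, hrel, div_eq_mul_inv]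
    have hmm : (m (ys i) : M ⧸ d.range) = m (ys i') := by
      rw [QuotientAddGroup.eq_iff_sub_mem]
      refine ⟨⟨Ψ (Additive.ofMul wu), hwM⟩, Subtype.ext ?_⟩
      rw [AddSubgroupClass.coe_sub, hmx, hmx]
      exact hdiff.symm
    exact Subtype.ext (by rw [← hmy (ys i), ← hmy (ys i'), hmm])
  -- hence the `2^k`-torsion of the coinvariants is finite of order `≤ 2`
  haveI hfin : Finite {y : M ⧸ d.range // 2 ^ k • y = 0} := by
    by_contra hinf
    rw [not_finite_iff_infinite] at hinf
    let emb := Infinite.natEmbedding {y : M ⧸ d.range // 2 ^ k • y = 0}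
    obtain ⟨i, i', hii', h⟩ := key3 (fun i : Fin 3 ↦ emb i)
    exact hii' (Fin.ext (emb.injective h))
  have hcard : Nat.card {y : M ⧸ d.range // 2 ^ k • y = 0} ≤ 2 := by
    by_contra hlt
    push Not at hlt
    letI := Fintype.ofFinite {y : M ⧸ d.range // 2 ^ k • y = 0}
    rw [Nat.card_eq_fintype_card] at hlt
    let emb : Fin 3 ↪ {y : M ⧸ d.range // 2 ^ k • y = 0} :=
      (Fin.castLEEmb hlt).trans (Fintype.equivFin _).symm.toEmbedding
    obtain ⟨i, i', hii', h⟩ := key3 emb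
    exact hii' (emb.injective h)
  -- BRICK 11 at `m = 2^k`
  have h11 := finite_torsionBy_localTowerKerPrimary_and_card_le W κ (v.adicCompletion ℚ) 0 hgn hgen (2 ^ k)
  exact ⟨h11.1, h11.2.trans hcard⟩

/-- **`𝒦_{v,0}[2^∞]` is FINITE OF ORDER `≤ 2` when `ord_v(Δ_min)` is ODD — KERNEL theorem.** For a globally minimal `W/ℚ`,
multiplicative and NON-SPLIT at `2` with `ord_v(Δ_min)` odd (equivalently Tamagawa number `c₂ = 1`, *AEC* C.15), every
cyclotomic `ℤ₂`-datum `κ` and the place `v ∋ 2`: the layer-`0` local tower kernel has at most `2` elements — the upper half of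
Greenberg's «If p = 2, then `|ker(r_v)| = 2c_v^{(p)}`» in the case `c_v = 1`. By
`powTorsion_localTowerKerPrimary_zero_le_two_nonsplitTwo_of_odd` and `2`-primary exhaustion.
[cite: GreenbergLNM1716, §4 pp. 112–113; §3 p. 93] [cite: SilvermanAEC2009, C.15 Table 15.1] -/
theorem finite_and_natCard_localTowerKerPrimary_zero_le_two_nonsplitTwo_of_odd (W : WeierstrassCurve ℚ) [W.IsElliptic]
    [W.IsGloballyMinimal] (hmult : W.HasMultiplicativeReductionAtPrime 2)
    (hns : ¬ W.HasSplitMultiplicativeReductionAtPrime 2) (hκ : κ.IsCyclotomic) (v : HeightOneSpectrum (𝓞 ℚ))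
    (hv : ((2 : ℕ) : 𝓞 ℚ) ∈ v.asIdeal) (hodd : Odd (W.ordMinimalDiscriminant v)) :
    Finite (W.localTowerKerPrimary κ (v.adicCompletion ℚ) 0) ∧
      Nat.card (W.localTowerKerPrimary κ (v.adicCompletion ℚ) 0) ≤ 2 := by
  refine finite_and_natCard_le_of_forall_torsionBy_pow 2 2 (fun x ↦ ?_)
    (fun k ↦ powTorsion_localTowerKerPrimary_zero_le_two_nonsplitTwo_of_odd W hmult hns hκ v hv hodd k)
  obtain ⟨-, k, hk⟩ := (W.mem_localTowerKerPrimary_iff κ (v.adicCompletion ℚ) 0 x.1).mp x.2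
  exact ⟨k, Subtype.ext (by rw [AddSubgroupClass.coe_nsmul, hk]; rfl)⟩

end Summit.BirchSwinnertonDyer.BirchSwinnertonDyer.Theorems.MultTowerNS2LayerZero

end
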